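import Summits.AtomisticToContinuum.Crystallization.Theses.PhononSlackCertificates
import Summits.AtomisticToContinuum.Crystallization.Theorems.PhononSlackCertificatesHullBridgeBadFraction
import Summits.AtomisticToContinuum.Crystallization.Theorems.PhononSlackCertificatesHullBridgeNonLayeredFraction
import Summits.AtomisticToContinuum.Crystallization.Theorems.PhononSlackCertificatesHullBridgeCleanCentres
import Summits.AtomisticToContinuum.Crystallization.Theorems.PhononSlackCertificatesHullBridgeWindowsOfGluing
import Summits.AtomisticToContinuum.Crystallization.Theorems.ReggeStarCoercivityDefectFreeCrystallizesLayeredGluing02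

/-!
# `HullBridge` (route `PhononSlackCertificates`, item stmt-AtomisticToContinuum-15147), line `Sketch`:
# the bridge MODULO THE GLUING LEMMA — `LayeredGluing → HullBridge` and `ExactLayeredRigidity → HullBridge`

The line's composition with its four landed soft stubs (S1 `stub_badFraction`, S2 `stub_nonLayeredFraction`,
S3 `stub_cleanCentres`, S5 `stub_windowsOfGluing`, all in this namespace) leaves exactly ONE hypothesis, the
potential-free gluing lemma `PrestressSplitKorn.LayeredGluing` (S4; tree Prop of the sibling crux
`DefectFreeCrystallizes`, line `prestress-split-korn`), or — through the landed compactness half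
`PrestressSplitKorn.layeredGluing_of_exactRigidity` — the exact local-to-global rigidity of box-layered sets
`PrestressSplitKorn.ExactLayeredRigidity`. Both reductions are recorded here sorry-free:

* `hullBridge_of_layeredGluing : LayeredGluing → HullBridge`;
* `hullBridge_of_exactLayeredRigidity : ExactLayeredRigidity → HullBridge`.

Mechanism (Theses docstring of `HullBridge`): ground states are `δ`-separated and `E(N) − N e* = o(N)`, so the
coercive gap makes the bad fraction vanish (S1); the near field at fixed `η` with `Ω :=` the good sites makes the
non-`η`-layered fraction vanish (S2); packing gives clean centres of any radius for all large `N` (S3); gluing at a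
clean centre gives an `(R, ε)`-window of some spacing eventually, and compactness in the spacing gives one spacing
for all scales frequently (S5). No new definitions; the hypotheses are tree Props, not named Literature facts.
-/

noncomputable section

namespace Summit.AtomisticToContinuum.Crystallization.Theorems.HullBridgeExact

open Summit.AtomisticToContinuum.Crystallization.Theses.PhononSlackCertificates

/-- **`HullBridge` modulo the gluing lemma.** The potential-free gluing lemma `LayeredGluing` (η-layered
2-balls around a clean centre of radius `R'` glue to ONE box-layered window on `B(0, R)`) implies the bridge
`CoerciveTwoShellGap → NearFieldConvexity → layered windows of every Lennard-Jones ground-state sequence`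
(composition of the landed stubs S1, S2, S3, S5 of line `Sketch`). -/
theorem hullBridge_of_layeredGluing :
    Summit.AtomisticToContinuum.Crystallization.Theorems.PrestressSplitKorn.LayeredGluing →
      Summit.AtomisticToContinuum.Crystallization.Theses.PhononSlackCertificates.HullBridge := by
  intro hG hCG hNF x hx
  have hbad := stub_badFraction hCG x hx
  exact stub_windowsOfGluing hG x hx
    (fun η hη R' => stub_cleanCentres x hx hbad (fun η' hη' => stub_nonLayeredFraction hNF x hx hbad hη') hη R')

/-- **`HullBridge` modulo exact rigidity.** The exact local-to-global rigidity of box-layered sets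
`ExactLayeredRigidity` (a nonempty uniformly discrete set of `ℝ³` exactly box-layered on every open 2-ball is one
rigid image of one box template) implies the bridge, through the landed compactness half
`PrestressSplitKorn.layeredGluing_of_exactRigidity`. -/
theorem hullBridge_of_exactLayeredRigidity :
    Summit.AtomisticToContinuum.Crystallization.Theorems.PrestressSplitKorn.ExactLayeredRigidity →
      Summit.AtomisticToContinuum.Crystallization.Theses.PhononSlackCertificates.HullBridge :=
  fun h => hullBridge_of_layeredGluing (PrestressSplitKorn.layeredGluing_of_exactRigidity h)

end Summit.AtomisticToContinuum.Crystallization.Theorems.HullBridgeExact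

end
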